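import Summits.ResolutionOfSingularities.ResolutionOfSingularities.Theorems.FrobeniusLadderFRationalResolutionVeroneseDegreeSplit
import HarnessLib

/-!
# Crux `FrobeniusLadder.FRationalResolution` (stmt-ResolutionOfSingularities-15317), line `redirect`,
# stub `stub_diagonalizableQuotientResolution` — the exponent monoid of the Veronese cone is the weight kernel `{m : r ∣ |m|}`

`…MonomialAlgebraCompletionVeronese.hloc_of_ringEquiv_monoidPowerSeries_veronese` asks for `κ⟦P⟧ ≃+* Ê` with `P = ⟨d : |d| = r⟩`, while the
(S1)/(E) side of the recipe (`…HfinOfChartData`, `…WeightZeroNonPrincipal`) describes the exponent monoid of `1/r(1,…,1)` as the WEIGHT KERNEL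
`{m : r ∣ |m|}`. They agree:

* `mem_closure_degree_eq_iff` — `m ∈ ⟨d : |d| = r⟩ ↔ r ∣ |m|` (`stub_finsupp_degree_split`, p795532 era).

Honest label: bookkeeping (no stub, crux or summit closed). No definitions, no named facts, no sorry. [folklore]
-/

-- single-problem summit: the doubled namespace component is forced
set_option linter.dupNamespace false

namespace Summit.ResolutionOfSingularities.ResolutionOfSingularities.Theorems.FRationalResolution.MonomialAlgebraCompletion

/-- **`⟨d : |d| = r⟩ = {m : r ∣ |m|}`**: the submonoid of `ℕⁿ` generated by the degree-`r` exponents is the kernel of the degree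
mod `r`. [folklore] -/
theorem mem_closure_degree_eq_iff (n r : ℕ) (m : Fin n →₀ ℕ) :
    m ∈ AddSubmonoid.closure {d : Fin n →₀ ℕ | Finsupp.degree d = r} ↔ r ∣ Finsupp.degree m := by
  constructor
  · intro hm
    induction hm using AddSubmonoid.closure_induction with
    | mem x hx => exact ⟨1, by rw [mul_one]; exact hx⟩
    | zero => exact ⟨0, by rw [map_zero, mul_zero]⟩
    | add x y _ _ hx hy => rw [map_add]; exact dvd_add hx hy
  · rintro ⟨s, hs⟩
    obtain ⟨e, he, rfl⟩ := stub_finsupp_degree_split r s m hs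
    exact sum_mem fun j _ => AddSubmonoid.subset_closure (he j)

end Summit.ResolutionOfSingularities.ResolutionOfSingularities.Theorems.FRationalResolution.MonomialAlgebraCompletion
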